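import Summits.RiemannHypothesis.RiemannHypothesis.Theorems.WeilGroundStateGroundStateSimpleEvenIncrementSplit
import Literature.NumberTheory.LFunctions.WeilArchDensityPanelCheck
import HarnessLib

/-!
# RiemannHypothesis / GroundBarta — rung 4 (`EvenWinsBeyondArch`, stmt-RiemannHypothesis-18807 / 18085):
# the deflated Temple L-side, A-layer II — certified archimedean energy of a scaled window polynomial `P(x/b)`

Helper file (`--supports`), RH-free, no definitions, no named facts.  Prover A, speedrun unit `sr-gb-rung-a` (gen 2).

The trial vectors of the G3 certificates are `v(x) = 𝟙_{[-b,b]}(x) · P(x/b)` with `P` a rational (dyadic) coefficient list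
in the normalised variable `y = x/b` — this keeps every exact rational of the certificate small (no powers of `b`).  For
them (`dt_weilIncrement_windowPolyY_*`) `D_t(v) = 2b‖P‖² − 2b C_P(t/b)` on `[0, 2b]` (`C_P = corr P P 1`) and `= 2b‖P‖²`
beyond, `‖P‖² = ∫_{-1}^{1} P² = integPolyQ P P 1`; so with an increment polynomial `E` CERTIFIED BY INTERPOLATION
(`ExpPoly/CorrelationCert.lean`: `τ E(τ) = d(0) − d(τ)`, `d = 2 C_P`, hypothesis `hE`) one has `D_t(v) = t · E(t/b)` and
(`dt_archEnergy_windowPolyY_eq`)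

  `∫_{(0,∞)} ρ D(v) = b ∫₀² g(bτ) E(τ) dτ + 2b‖P‖² ∫_{(2b,∞)} ρ`,   `g(t) = tρ(t)`.

`dt_archEnergy_windowPolyY_mem` then turns the kernel certificates of `WeilArchDensityPanelCheck.lean` — `N` per-panel checks
`archPanelCheck` (slope `b`, half-width `1/N`) with bounds `Ilo k, Ihi k`, and the tail check — into the two-sided enclosure

  `b Σ Ilo + 2b‖P‖² Tlo ≤ ∫_{(0,∞)} ρ D(v) ≤ b Σ Ihi + 2b‖P‖² Thi`.

References: E. Bombieri, Rend. Mat. Acc. Lincei (9) 11 (2000) 183–233, Thm 2 [Bombieri2000Weil].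
-/

set_option linter.dupNamespace false

noncomputable section

open MeasureTheory Set Filter intervalIntegral
open scoped Topology BigOperators

namespace Summit.RiemannHypothesis.RiemannHypothesis.Theorems.EvenWinsBeyondArch

open Literature.NumberTheory.LFunctions Literature.Analysis.ValidatedNumerics.ExpPoly
open Literature.Analysis.ValidatedNumerics.PolyMP
open Summit.RiemannHypothesis.RiemannHypothesis.Theorems.GroundStateSimpleEven
  (incs_weilIncrement_eq incs_weilIncrement_of_ge incs_integral_mul_of_le)

/-- `∫_{-b}^{b} P(x/b)² dx = b · integPolyQ P P 1`. [folklore] -/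
theorem dt_normSq_windowPolyY_eq (P : Poly) {b : ℚ} (hb : 0 < b) :
    ∫ x in (-(b : ℝ))..b, Poly.eval P (x / b) ^ 2 = (b : ℝ) * ((integPolyQ P P 1 : ℚ) : ℝ) := by
  have hb' : (b : ℝ) ≠ 0 := by exact_mod_cast hb.ne'
  rw [intervalIntegral.integral_comp_div (fun y ↦ Poly.eval P y ^ 2) hb', neg_div, div_self hb', smul_eq_mul]
  have h1 := integral_eval_mul_eval P P 1
  push_cast at h1
  rw [← h1]
  congr 1
  exact integral_congr fun x _ ↦ by simp only [pow_two]

/-- The cross term: `∫_{-b}^{b-t} P((x+t)/b) P(x/b) dx = b · C_P(t/b)`, `C_P = corr P P 1`. [folklore] -/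
theorem dt_cross_windowPolyY_eq (P : Poly) {b : ℚ} (hb : 0 < b) (t : ℝ) :
    ∫ x in (-(b : ℝ))..((b : ℝ) - t), Poly.eval P ((x + t) / b) * Poly.eval P (x / b) =
      (b : ℝ) * Poly.eval (Poly.corr P P 1) (t / b) := by
  have hb' : (b : ℝ) ≠ 0 := by exact_mod_cast hb.ne'
  have h := intervalIntegral.integral_comp_div (fun y ↦ Poly.eval P (y + t / b) * Poly.eval P y) hb'
    (a := -(b : ℝ)) (b := (b : ℝ) - t)
  have e1 : ∀ x : ℝ, Poly.eval P ((x + t) / b) * Poly.eval P (x / b) = Poly.eval P (x / b + t / b) * Poly.eval P (x / b) := by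
    intro x; rw [add_div]
  simp_rw [e1]
  rw [h, Poly.eval_corr, smul_eq_mul]
  congr 1
  rw [neg_div, div_self hb', sub_div, div_self hb']
  push_cast
  rfl

/-- **Increments of a scaled window polynomial on `[0, 2b]`**: with a certified increment polynomial `E`
(`τ E(τ) = d(0) − d(τ)`, `d = 2 corr P P 1`), `D_t(𝟙_{[-b,b]} P(·/b)) = t · E(t/b)`. [folklore] -/
theorem dt_weilIncrement_windowPolyY_of_le (P E : Poly) {b : ℚ} (hb : 0 < b)
    (hE : ∀ τ : ℝ, τ * Poly.eval E τ = Poly.eval (Poly.smul 2 (Poly.corr P P 1)) 0 - Poly.eval (Poly.smul 2 (Poly.corr P P 1)) τ)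
    {t : ℝ} (ht : 0 ≤ t) (ht2 : t ≤ 2 * (b : ℝ)) :
    weilIncrement (fun x : ℝ ↦ (((Set.Icc (-(b : ℝ)) b).indicator (fun x ↦ Poly.eval P (x / b)) x : ℝ) : ℂ)) t =
      t * Poly.eval E (t / b) := by
  have hbr : (0 : ℝ) < b := by exact_mod_cast hb
  have hcont : Continuous fun x : ℝ ↦ Poly.eval P (x / b) := (Poly.continuous_eval P).comp (continuous_id.div_const _)
  rw [incs_weilIncrement_eq hcont hbr ht, incs_integral_mul_of_le (fun x ↦ Poly.eval P (x / b)) ht2]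
  have hcross := dt_cross_windowPolyY_eq P hb t
  rw [hcross, dt_normSq_windowPolyY_eq P hb]
  have h0 := dt_cross_windowPolyY_eq P hb 0
  simp only [add_zero, sub_zero, zero_div] at h0
  have hG : (b : ℝ) * ((integPolyQ P P 1 : ℚ) : ℝ) = (b : ℝ) * Poly.eval (Poly.corr P P 1) 0 := by
    rw [← h0, ← integral_eval_mul_eval]
    rw [intervalIntegral.integral_comp_div (fun y ↦ Poly.eval P y * Poly.eval P y) hbr.ne', neg_div, div_self hbr.ne',
      smul_eq_mul]
    push_cast; ring_nf
  have hEt := hE (t / b)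
  rw [Poly.eval_smul, Poly.eval_smul] at hEt
  push_cast at hEt
  have : t * Poly.eval E (t / b) = (b : ℝ) * (t / b * Poly.eval E (t / b)) := by field_simp
  rw [this, hEt, hG]
  ring

/-- **Increments of a scaled window polynomial beyond `2b`**: `D_t = 2b · integPolyQ P P 1`. [folklore] -/
theorem dt_weilIncrement_windowPolyY_of_ge (P : Poly) {b : ℚ} (hb : 0 < b) {t : ℝ} (ht : 2 * (b : ℝ) ≤ t) :
    weilIncrement (fun x : ℝ ↦ (((Set.Icc (-(b : ℝ)) b).indicator (fun x ↦ Poly.eval P (x / b)) x : ℝ) : ℂ)) t =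
      2 * ((b : ℝ) * ((integPolyQ P P 1 : ℚ) : ℝ)) := by
  have hcont : Continuous fun x : ℝ ↦ Poly.eval P (x / b) := (Poly.continuous_eval P).comp (continuous_id.div_const _)
  rw [incs_weilIncrement_of_ge hcont (by exact_mod_cast hb) ht, dt_normSq_windowPolyY_eq P hb]

/-- **The archimedean energy of a scaled window polynomial**: integrability on `(0, ∞)` and
`∫_{(0,∞)} ρ D = b ∫₀² g(bτ) E(τ) dτ + 2b‖P‖² ∫_{(2b,∞)} ρ`. [cite: Bombieri2000Weil, Thm 2] -/
theorem dt_archEnergy_windowPolyY_eq (P E : Poly) {b : ℚ} (hb : 0 < b)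
    (hE : ∀ τ : ℝ, τ * Poly.eval E τ = Poly.eval (Poly.smul 2 (Poly.corr P P 1)) 0 - Poly.eval (Poly.smul 2 (Poly.corr P P 1)) τ) :
    IntegrableOn (fun t ↦ weilArchDensity t *
        weilIncrement (fun x : ℝ ↦ (((Set.Icc (-(b : ℝ)) b).indicator (fun x ↦ Poly.eval P (x / b)) x : ℝ) : ℂ)) t)
        (Set.Ioi 0) ∧
      ∫ t in Set.Ioi 0, weilArchDensity t *
          weilIncrement (fun x : ℝ ↦ (((Set.Icc (-(b : ℝ)) b).indicator (fun x ↦ Poly.eval P (x / b)) x : ℝ) : ℂ)) t =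
        (b : ℝ) * (∫ τ in (0 : ℝ)..2, weilArchDensityG ((b : ℝ) * τ) * Poly.eval E τ) +
          2 * ((b : ℝ) * ((integPolyQ P P 1 : ℚ) : ℝ)) * ∫ t in Set.Ioi (2 * (b : ℝ)), weilArchDensity t := by
  set v : ℝ → ℂ := fun x : ℝ ↦ (((Set.Icc (-(b : ℝ)) b).indicator (fun x ↦ Poly.eval P (x / b)) x : ℝ) : ℂ) with hv
  set G2 : ℝ := 2 * ((b : ℝ) * ((integPolyQ P P 1 : ℚ) : ℝ)) with hG2
  have hbr : (0 : ℝ) < b := by exact_mod_cast hb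
  have h2b : (0 : ℝ) < 2 * b := by positivity
  have hEcont : Continuous fun t : ℝ ↦ Poly.eval E (t / b) := (Poly.continuous_eval E).comp (continuous_id.div_const _)
  have hEq1 : EqOn (fun t ↦ weilArchDensity t * weilIncrement v t) (fun t ↦ weilArchDensityG t * Poly.eval E (t / b))
      (Set.Ioc 0 (2 * (b : ℝ))) := by
    intro t ht
    simp only [hv]
    rw [dt_weilIncrement_windowPolyY_of_le P E hb hE ht.1.le ht.2, weilArchDensity_mul_mul ht.1]
  have hEq2 : EqOn (fun t ↦ weilArchDensity t * weilIncrement v t) (fun t ↦ weilArchDensity t * G2)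
      (Set.Ioi (2 * (b : ℝ))) := by
    intro t ht
    simp only [hv]
    rw [dt_weilIncrement_windowPolyY_of_ge P hb (le_of_lt ht)]
  have hI1 : IntegrableOn (fun t ↦ weilArchDensityG t * Poly.eval E (t / b)) (Set.Ioc 0 (2 * (b : ℝ))) :=
    (intervalIntegrable_iff_integrableOn_Ioc_of_le h2b.le).1
      (intervalIntegrable_weilArchDensityG_mul le_rfl h2b.le hEcont)
  have hI2 : IntegrableOn (fun t ↦ weilArchDensity t * G2) (Set.Ioi (2 * (b : ℝ))) :=
    (weilArchDensity_tail_eq_sum_add h2b 0).1.mul_const G2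
  have hI1' : IntegrableOn (fun t ↦ weilArchDensity t * weilIncrement v t) (Set.Ioc 0 (2 * (b : ℝ))) :=
    hI1.congr_fun hEq1.symm measurableSet_Ioc
  have hI2' : IntegrableOn (fun t ↦ weilArchDensity t * weilIncrement v t) (Set.Ioi (2 * (b : ℝ))) :=
    hI2.congr_fun hEq2.symm measurableSet_Ioi
  have hunion : Set.Ioc (0 : ℝ) (2 * b) ∪ Set.Ioi (2 * b) = Set.Ioi 0 := Ioc_union_Ioi_eq_Ioi h2b.le
  -- the substitution `t = bτ` in the bulk
  have hsub : ∫ t in (0 : ℝ)..(2 * b), weilArchDensityG t * Poly.eval E (t / b) =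
      (b : ℝ) * ∫ τ in (0 : ℝ)..2, weilArchDensityG ((b : ℝ) * τ) * Poly.eval E τ := by
    have h := intervalIntegral.integral_comp_div (fun τ ↦ weilArchDensityG ((b : ℝ) * τ) * Poly.eval E τ) hbr.ne'
      (a := (0 : ℝ)) (b := 2 * (b : ℝ))
    have e : ∀ t : ℝ, weilArchDensityG ((b : ℝ) * (t / b)) * Poly.eval E (t / b) = weilArchDensityG t * Poly.eval E (t / b) := by
      intro t; rw [mul_div_cancel₀ t hbr.ne']
    simp_rw [e] at h
    rw [h, zero_div, smul_eq_mul]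
    congr 2
    field_simp
  refine ⟨?_, ?_⟩
  · rw [← hunion]; exact hI1'.union hI2'
  · rw [← hunion, setIntegral_union (Ioc_disjoint_Ioi_same) measurableSet_Ioi hI1' hI2',
      setIntegral_congr_fun measurableSet_Ioc hEq1, setIntegral_congr_fun measurableSet_Ioi hEq2,
      ← intervalIntegral.integral_of_le h2b.le, MeasureTheory.integral_mul_const, hsub]
    ring

/-- **Kernel-certified enclosure of the archimedean energy of a scaled window polynomial.**  Hypotheses: the
interpolation certificate `hE` for `E`, `N ≥ 1` per-panel certificates `archPanelCheck` (slope `b`, half-width `1/N`)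
with bounds `Ilo k, Ihi k`, and the tail certificate. [cite: Bombieri2000Weil, Thm 2] -/
theorem dt_archEnergy_windowPolyY_mem (P E : Poly) {b : ℚ} (hb : 0 < b) (hb2 : b ≤ 2)
    (hE : ∀ τ : ℝ, τ * Poly.eval E τ = Poly.eval (Poly.smul 2 (Poly.corr P P 1)) 0 - Poly.eval (Poly.smul 2 (Poly.corr P P 1)) τ)
    {S : ℕ} (hS : 0 < S) {N : ℕ} (hN : 0 < N) {D K Kφ lam Ke ke : ℕ} (hK : 0 < K) (hKφ : 0 < Kφ) (hlam : 0 < lam)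
    (Q : ℕ → List ℤ) (e : ℕ → ℕ) (ps : ℕ → Poly) (Ilo Ihi : ℕ → ℚ)
    (hall : ∀ k, k < N → archPanelCheck S (1 / N) D K Kφ lam Ke ke k (Q k) (e k) (ps k) E b (Ilo k) (Ihi k) = true)
    {KeT keT M : ℕ} (htail : archTailCheck S KeT keT M b = true) :
    ((b * (∑ k ∈ Finset.range N, Ilo k) + 2 * (b * integPolyQ P P 1) * (archTailBounds S KeT keT M b).1 : ℚ) : ℝ) ≤
        ∫ t in Set.Ioi 0, weilArchDensity t *
          weilIncrement (fun x : ℝ ↦ (((Set.Icc (-(b : ℝ)) b).indicator (fun x ↦ Poly.eval P (x / b)) x : ℝ) : ℂ)) t ∧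
      ∫ t in Set.Ioi 0, weilArchDensity t *
          weilIncrement (fun x : ℝ ↦ (((Set.Icc (-(b : ℝ)) b).indicator (fun x ↦ Poly.eval P (x / b)) x : ℝ) : ℂ)) t ≤
        ((b * (∑ k ∈ Finset.range N, Ihi k) + 2 * (b * integPolyQ P P 1) * (archTailBounds S KeT keT M b).2 : ℚ) : ℝ) := by
  have hN' : (0 : ℚ) < N := by exact_mod_cast hN
  have h0 : (0 : ℚ) < 1 / N := by positivity
  have hsh : b * (1 / N) ≤ 2 := by
    have : (1 : ℚ) / N ≤ 1 := by rw [div_le_one hN']; exact_mod_cast hN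
    nlinarith
  obtain ⟨hXlo, hXhi⟩ := archBulk_of_panels hS h0 hb hsh hK hKφ hlam N Q e ps Ilo Ihi hall
  obtain ⟨hTlo, hThi⟩ := archTail_sound hS hb htail
  rw [(dt_archEnergy_windowPolyY_eq P E hb hE).2]
  have hcast : (2 : ℝ) = 2 * N * ((1 / N : ℚ) : ℝ) := by
    have hNr : (N : ℝ) ≠ 0 := by exact_mod_cast hN.ne'
    push_cast
    field_simp
  rw [← hcast] at hXlo hXhi
  have hbr : (0 : ℝ) < b := by exact_mod_cast hb
  have hG : (0 : ℝ) ≤ ((integPolyQ P P 1 : ℚ) : ℝ) := by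
    have h := dt_normSq_windowPolyY_eq P hb
    have hnn : (0 : ℝ) ≤ ∫ x in (-(b : ℝ))..b, Poly.eval P (x / b) ^ 2 :=
      intervalIntegral.integral_nonneg (by linarith) fun x _ ↦ sq_nonneg _
    rw [h] at hnn
    exact nonneg_of_mul_nonneg_right (by linarith [hnn]) hbr |> fun h' ↦ by nlinarith [hnn, h']
  set X := ∫ τ in (0 : ℝ)..2, weilArchDensityG ((b : ℝ) * τ) * Poly.eval E τ with hX
  set T := ∫ t in Set.Ioi (2 * (b : ℝ)), weilArchDensity t with hT
  have hG2 : (0 : ℝ) ≤ 2 * ((b : ℝ) * ((integPolyQ P P 1 : ℚ) : ℝ)) := by positivity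
  have hGT1 : 2 * ((b : ℝ) * ((integPolyQ P P 1 : ℚ) : ℝ)) * (((archTailBounds S KeT keT M b).1 : ℚ) : ℝ) ≤
      2 * ((b : ℝ) * ((integPolyQ P P 1 : ℚ) : ℝ)) * T := mul_le_mul_of_nonneg_left hTlo hG2
  have hGT2 : 2 * ((b : ℝ) * ((integPolyQ P P 1 : ℚ) : ℝ)) * T ≤
      2 * ((b : ℝ) * ((integPolyQ P P 1 : ℚ) : ℝ)) * (((archTailBounds S KeT keT M b).2 : ℚ) : ℝ) :=
    mul_le_mul_of_nonneg_left hThi hG2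
  have hbX1 : (b : ℝ) * ((∑ k ∈ Finset.range N, Ilo k : ℚ) : ℝ) ≤ (b : ℝ) * X := mul_le_mul_of_nonneg_left hXlo hbr.le
  have hbX2 : (b : ℝ) * X ≤ (b : ℝ) * ((∑ k ∈ Finset.range N, Ihi k : ℚ) : ℝ) := mul_le_mul_of_nonneg_left hXhi hbr.le
  push_cast at hbX1 hbX2 ⊢
  constructor <;> linarith

end Summit.RiemannHypothesis.RiemannHypothesis.Theorems.EvenWinsBeyondArch

end
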